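import Summits.BirchSwinnertonDyer.BirchSwinnertonDyer.Theorems.EisensteinDepletionAtTwoStarNsfDoorThreePrints
import Summits.BirchSwinnertonDyer.BirchSwinnertonDyer.Theorems.EisensteinDepletionAtTwoStarE1MNSFDoor
import HarnessLib

/-!
# E1M with the Abbes–Ullmo print replaced by its EXACT residue «the optimal Manin constant is odd at odd level, for optimal curves that are
# good ordinary at 2 and carry an étale rational 2-torsion point» (lead star-p1 GEN 21, 2026-08-29)

Line `star` v16 reads the aside crux E1M (stmt-BirchSwinnertonDyer-20341) modulo modularity + {(F), Abbes–Ullmo Thm A, UBD}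
(`SigmaNode.depletedLambdaLawAtTwoMod_of_threePrints`).  Abbes–Ullmo's Thm A (`abbesUllmo_not_dvd_maninConstant_of_not_dvd_level`: EVERY
prime `p ∤ N`, EVERY optimal datum) is consumed at exactly one point — `KummerDoor.discrepancyCover_of` turns it into `Odd q` for the
`X₀(N)`-lattice-optimal minimal model `W₀` (`Λ₀ = q·Λ_f`), which feeds K-Θ.  This file re-threads that one point through the DISPLAYED
HYPOTHESIS (written inline; no definition is introduced)

  (OddManin₂)  for every globally minimal elliptic `W₀/ℚ` with newform `f ∈ S₂(Γ₀(N))`, `2 ∤ N`, `W₀` good ORDINARY at `2`, Néron-type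
               lattice `Λ₀ = q·Λ_f` EXACTLY (`q ∈ ℤ`), and a rational `2`-torsion abscissa `x₀` NOT ramified at `2`: `q` is odd,

which is the case `p = 2` of Abbes–Ullmo's theorem restricted to the curves the door actually meets (`oddManinAtTwo_of_abbesUllmo` records the
implication; Edixhoven's integrality `q ∈ ℤ` is the TREE THEOREM `edixhoven_optimalManinConstant_integral_holds`).  Results:

* `discrepancyCover_of_oddManin : (OddManin₂) → K-D → K-U → K-Θ → stub_discrepancyCover` (the proof of `discrepancyCover_of` verbatim with the
  one Abbes–Ullmo line replaced);
* `starGO2Sigma_of_modularity_oddManin_ubd : modularity → (OddManin₂) → UBD → StarGO2Sigma` (27046);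
* `depletedLambdaLawAtTwoMod_of_cusp_oddManin_ubd : (F) → (OddManin₂) → UBD → DepletedLambdaLawAtTwoMod` (E1M, 20341, all conductors);
* `depletedLambdaLawAtTwoModNSF_of_cusp_oddManin_ubd` — the same for E1M_NSF (27021);
* `oddManinAtTwo_of_abbesUllmo` — (OddManin₂) ⟸ Abbes–Ullmo Thm A (so nothing here is stronger than v16's currency; composing it with
  `depletedLambdaLawAtTwoMod_of_cusp_oddManin_ubd` is v16's door `SigmaNode.depletedLambdaLawAtTwoMod_of_threePrints` by name).

WHY (repair census GEN 21, memo Cruxes/…/Lines/star-AU-parity-gen21.md): (OddManin₂) is the precise statement a parity-free route would have to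
supply — a hypothetical even `q` makes the UNTWISTED Kummer function `sqrt(x∘φ₀ − x₀)·(−x/y)∘φ₀` integral at `∞` (even-multiple square law,
numerics 15a1/21a1/33a1/39a1), so UBD + Wohlfahrt give `Λ₁(f) ⊆ ℤλ_f + 2Λ_f`, i.e. the étale `P₀` lies in the kernel of the dual Stevens isogeny
`E₀ → E₁`; closing that needs the 2-primary étaleness of the cusp-image group on `E₁` ((F₂), not in print: Vatsal 2005 treats odd ℓ only).
HONEST FRAMING (Barrier B1): CONDITIONAL RESULTS on displayed/named hypotheses the tree does not prove; items 20341 / 27021 / 27046 are NOT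
closed; BSD is NOT proved (PARTITION D-0054: none — r_an ≥ 2, axis S0; no S0 motion).  No `sorry`, no definition.
-/

set_option linter.dupNamespace false
set_option autoImplicit false

noncomputable section

namespace Summit.BirchSwinnertonDyer.BirchSwinnertonDyer.Theorems.DepletionAtTwo.KummerDoor

open scoped MatrixGroups ModularForm
open CongruenceSubgroup
open Literature.NumberTheory.EllipticCurves
open Literature.NumberTheory.EllipticCurves.Greenberg1999
open Literature.NumberTheory.EllipticCurves.ModularForms
open Literature.NumberTheory.ModularForms
open Summit.BirchSwinnertonDyer.BirchSwinnertonDyer.Theorems.DepletionAtTwo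
open scoped Manifold

/-- **The discrepancy cover from (OddManin₂) instead of Abbes–Ullmo** — the proof of `discrepancyCover_of` (lead star-p1 GEN 13) verbatim, with
`q ∈ ℤ` from the tree theorem `edixhoven_optimalManinConstant_integral_holds` and `Odd q` from the displayed hypothesis applied to the optimal
`(W₀, f, Λ₀ = q·Λ_f)` (odd level by `stub_levelDetect`, good ordinary at `2` by Faltings + isogeny transport, étale `x₀` by assumption).
CONDITIONAL on the displayed hypothesis and on K-D / K-U / K-Θ (the latter two are tree theorems, fed below). [cite: Mazur1977, II §16–§17]
[cite: Stevens1982, §2.4–2.5] [cite: EdixhovenManin1991, Prop. 2] -/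
theorem discrepancyCover_of_oddManin
    (hOdd : ∀ (W₀ : WeierstrassCurve ℚ) [W₀.IsElliptic] [W₀.IsGloballyMinimal] ⦃N : ℕ⦄ [NeZero N]
      (f : CuspForm (Gamma0 N) 2), IsNewformOf W₀ f → ¬ 2 ∣ N → IsOrdinaryAt W₀ 2 →
      ∀ (L₀ : PeriodPair), IsNeronLatticeOf (W₀.baseChange ℂ) L₀ → ∀ (q : ℤ), q ≠ 0 →
      (∀ z ∈ periodLattice f, (q : ℂ) * z ∈ L₀.lattice) → (∀ z ∈ L₀.lattice, ∃ w ∈ periodLattice f, z = (q : ℂ) * w) →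
      ∀ (x₀ : ℚ), HasRationalTwoTorsionX W₀ x₀ → ¬ TwoTorsionRamifiedAtTwo x₀ → Odd q) :
    stub_dedekindEtaLog → stub_etaSqrt → stub_etaKummerTheta → stub_discrepancyCover := by
  intro hKD hKU hKT W _ _ W₀ _ _ N _ f hW hW₀ hord hN hN₀ L₀ hL₀ q hq hin hout x₀ hx₀ hnr lam hlam hlam2 hwp hβ
  obtain ⟨β, hadm⟩ := hβ
  refine ⟨β, hadm, fun g' hg Γ'' hΓ _ ↦ ?_⟩
  -- the print named facts and Dedekind's functional equation (stubs K-D and `stub_maninPrint`)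
  dsimp only [stub_dedekindEtaLog, stub_etaSqrt, stub_etaKummerTheta] at hKD hKU hKT
  have hEd : edixhoven_optimalManinConstant_integral := ModularForms.edixhoven_optimalManinConstant_integral_holds
  have hDed := hKD
  -- `q ∈ ℤ` (Edixhoven 1991, Prop. 2, lattice form)
  obtain ⟨qz, hqz⟩ := hEd hW₀ hL₀ q hin hout
  subst hqz
  have hqz0 : qz ≠ 0 := by
    rintro rfl
    exact hq (by simp)
  have hin' : ∀ z ∈ periodLattice f, (qz : ℂ) * z ∈ L₀.lattice := fun z hz ↦ by
    have h := hin z hz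
    rwa [Rat.cast_intCast] at h
  have hout' : ∀ z ∈ L₀.lattice, ∃ w ∈ periodLattice f, z = (qz : ℂ) * w := fun z hz ↦ by
    obtain ⟨w, hw, h⟩ := hout z hz
    exact ⟨w, hw, by rwa [Rat.cast_intCast] at h⟩
  -- `N` is odd and at least `11`
  have h2N : ¬ 2 ∣ N :=
    (Summit.BirchSwinnertonDyer.BirchSwinnertonDyer.Theorems.EisensteinDepletionAtTwoStarOptBNSFStubLevelDetect.stub_levelDetect
      W f hW).1 hord
  have h11 : 11 ≤ N := by
    by_contra hlt
    have hf0 : f = 0 := cuspForm_two_gamma0_eq_zero_of_le_ten (by omega) f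
    have h1 : cuspCoeff f 1 = (W₀.LFunction 1 : ℂ) := hW₀.2 1
    rw [hf0, WeierstrassCurve.LFunction_apply_one] at h1
    have h0 : cuspCoeff (0 : CuspForm (Gamma0 N) 2) 1 = 0 :=
      (cuspCoeffₗ (one_mem_strictPeriods_coe_gamma0 N) 1).map_zero
    rw [h0] at h1
    norm_num at h1
  -- level = conductor; ordinarity of the optimal curve (Faltings + isogeny transport)
  subst hN
  have hiso : WeierstrassCurve.IsIsogenous W W₀ :=
    IsNewformOf.isIsogenous WeierstrassCurve.isIsogenous_iff_frobeniusTrace_eq_holds hW hW₀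
  have hord₀ : IsOrdinaryAt W₀ 2 :=
    Summit.BirchSwinnertonDyer.BirchSwinnertonDyer.Theorems.IsogenyMuShift.isOrdinaryAt_of_isIsogenous hiso hord
  -- `q` is odd: THE DISPLAYED HYPOTHESIS (the exact residue of Abbes–Ullmo Thm. A inside the door), applied to the optimal
  -- `(W₀, f, Λ₀ = q·Λ_f)` at odd level, good ordinary at `2`, with the étale rational `2`-torsion abscissa `x₀`
  have hqodd : Odd qz := hOdd W₀ f hW₀ h2N hord₀ L₀ hL₀ qz hqz0 hin' hout' x₀ hx₀ hnr
  -- clause (o) from the tree's cusp-evenness package: `g' ≠ 0`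
  obtain ⟨hg0, hcusp, -⟩ :=
    Summit.BirchSwinnertonDyer.BirchSwinnertonDyer.Theorems.DepletionAtTwo.CuspEvenness.cover_clauses_of_curveData
      W W₀ hord rfl hN₀ hx₀ hnr hadm hg
  -- (U) the square root of the Eisenstein `η`-quotient (stub K-U with stub K-D)
  obtain ⟨m, V, u, U, E, hud, hune, husq, humul, hUq, hE1, hUsq⟩ :=
    hKU (W.conductorNorm ℤ) β (Nat.odd_iff.mpr (Nat.two_dvd_ne_zero.mp h2N)) hadm g' hg hDed
  -- (Θ) the eta–Kummer square identity at `c = q` (stub K-Θ)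
  obtain ⟨R, hR1, hR⟩ := hKT W₀ hord₀ x₀ hx₀ hnr qz hqodd
  rw [hN₀] at hR
  -- (Z) the integral expansion of the formal parameter (tree: Honda integrality + the analytic expansion)
  choose kz hkz using
    Summit.BirchSwinnertonDyer.BirchSwinnertonDyer.Theorems.DepletionAtTwo.ParamIntegral.stub_paramIntegralFormal W₀ qz
  obtain ⟨-, -, A, hA⟩ :=
    Summit.BirchSwinnertonDyer.BirchSwinnertonDyer.Theorems.DepletionAtTwo.ParamExpansion.stub_paramExpansion
      W₀ f hW₀ L₀ hL₀ (qz : ℚ) (by exact_mod_cast hqz0)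
  set zq : PowerSeries ℤ := PowerSeries.mk kz with hzqdef
  have hzq : PowerSeries.map (Int.castRingHom ℚ) zq =
      W₀.formalExp.subst ((qz : ℚ) • (PowerSeries.mk fun j : ℕ ↦ ((W₀.LFunction j : ℤ) : ℚ) / j)) := by
    ext n
    rw [PowerSeries.coeff_map, hzqdef, PowerSeries.coeff_mk, eq_intCast, hkz n]
  have hzsum : ∃ A : ℝ, ∀ τ : UpperHalfPlane, A < τ.im →
      HasSum (fun n : ℕ ↦ ((PowerSeries.coeff n zq : ℤ) : ℂ) *
          Complex.exp (2 * Real.pi * Complex.I * (τ : ℂ)) ^ n)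
        (-(L₀.weierstrassP ((qz : ℂ) * eichlerIntegral f τ) - ((W₀.b₂ : ℚ) : ℂ) / 12) /
          ((L₀.derivWeierstrassP ((qz : ℂ) * eichlerIntegral f τ)
            - ((W₀.a₁ : ℚ) : ℂ) * (L₀.weierstrassP ((qz : ℂ) * eichlerIntegral f τ) - ((W₀.b₂ : ℚ) : ℂ) / 12)
            - ((W₀.a₃ : ℚ) : ℂ)) / 2)) := by
    refine ⟨A, fun τ hτ ↦ ?_⟩
    have hfun : (fun n : ℕ ↦ ((PowerSeries.coeff n zq : ℤ) : ℂ) * Complex.exp (2 * Real.pi * Complex.I * (τ : ℂ)) ^ n) =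
        fun n : ℕ ↦ ((PowerSeries.coeff n (W₀.formalExp.subst
          ((qz : ℚ) • (PowerSeries.mk fun j : ℕ ↦ ((W₀.LFunction j : ℤ) : ℚ) / j))) : ℚ) : ℂ) *
            Complex.exp (2 * Real.pi * Complex.I * (τ : ℂ)) ^ n := by
      funext n
      rw [hkz n, hzqdef, PowerSeries.coeff_mk, Rat.cast_intCast]
    rw [hfun]
    have h := hA τ hτ
    simp only [Rat.cast_intCast] at h
    exact h
  -- the Eisenstein periods of `Γ₁(N)` lie in `ℤ g'`
  have hper : ∀ γ : SL(2, ℤ), γ ∈ Gamma1 (W.conductorNorm ℤ) → ∃ n : ℤ,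
      stabEisensteinPeriod (W.conductorNorm ℤ) β (γ 0 0) (γ 0 1) (γ 1 0) (γ 1 1) = n * g' :=
    fun γ hγ ↦ (hg _).mp ⟨⟨γ, Gamma1_in_Gamma0 _ hγ⟩, rfl⟩
  -- the twisted group with the integer Manin constant
  have hΓ' : ∀ γ : SL(2, ℤ), γ ∈ Γ'' ↔ ∃ hγ : γ ∈ Gamma0 (W.conductorNorm ℤ), γ ∈ Gamma1 (W.conductorNorm ℤ) ∧
      ((∃ n : ℤ, stabEisensteinPeriod (W.conductorNorm ℤ) β (γ 0 0) (γ 0 1) (γ 1 0) (γ 1 1) = n * g' ∧ Even n) ↔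
        ∃ k : ℤ, ∃ w ∈ L₀.lattice, (qz : ℂ) * cuspSymbol f ⟨γ, hγ⟩ = (k : ℂ) * lam + 2 * w) := by
    intro γ
    rw [hΓ γ]
    simp only [Rat.cast_intCast]
  exact KummerSigma.kummerSqrtFormSigma_thetaLaw W₀ f hW₀ (by omega) L₀ hL₀ qz hqz0 hin' x₀ hx₀ lam hlam hlam2 hwp β g' hg0 hper
    hcusp Γ'' hΓ' m V u U E hud hune husq humul hUq hE1 hUsq R hR1 hR zq hzq hzsum
    (Summit.BirchSwinnertonDyer.BirchSwinnertonDyer.Theorems.DepletionAtTwo.Gamma1Bounded.stub_gamma1Bounded _ (by omega))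


/-- **`StarGO2Sigma` (27046) from modularity + (OddManin₂) + UBD** — the composition `StarGO2Sigma_of` of line `kummer` with the discrepancy cover
supplied by `discrepancyCover_of_oddManin` (K-D = `KummerPrints.stub_dedekindEtaLog`, K-U, K-Θ tree theorems; Carayol from modularity).
CONDITIONAL RESULT; 27046 is NOT closed. [cite: Stevens1982, §2.5] [cite: CalegariDimitrovTang2025, Thm. 1.0.1] -/
theorem starGO2Sigma_of_modularity_oddManin_ubd (hnf : exists_isNewformOf)
    (hOdd : ∀ (W₀ : WeierstrassCurve ℚ) [W₀.IsElliptic] [W₀.IsGloballyMinimal] ⦃N : ℕ⦄ [NeZero N]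
      (f : CuspForm (Gamma0 N) 2), IsNewformOf W₀ f → ¬ 2 ∣ N → IsOrdinaryAt W₀ 2 →
      ∀ (L₀ : PeriodPair), IsNeronLatticeOf (W₀.baseChange ℂ) L₀ → ∀ (q : ℤ), q ≠ 0 →
      (∀ z ∈ periodLattice f, (q : ℂ) * z ∈ L₀.lattice) → (∀ z ∈ L₀.lattice, ∃ w ∈ periodLattice f, z = (q : ℂ) * w) →
      ∀ (x₀ : ℚ), HasRationalTwoTorsionX W₀ x₀ → ¬ TwoTorsionRamifiedAtTwo x₀ → Odd q)
    (hU : Literature.NumberTheory.Automorphic.CalegariDimitrovTang2025_unboundedDenominators) :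
    Summit.BirchSwinnertonDyer.BirchSwinnertonDyer.Theses.EisensteinDepletionAtTwo.StarGO2Sigma := by
  intro W _ _ W₀ _ _ N _ f hf hf₀ hord L₀ hL₀ q hq hin hout x₀ hx₀ hnr lam hlam hlam2 h℘ hβ
  have h4 : stub_levelEqConductor := stub_levelEqConductor_of_modularity hnf
  have hD : stub_discrepancyCover :=
    discrepancyCover_of_oddManin hOdd KummerPrints.stub_dedekindEtaLog KummerSigma.EtaSqrt.stub_etaSqrt Holds.stub_etaKummerTheta
  have hP : stub_gammaOneParity := gammaOneParity_of_cover (gammaOneCover_of_cut h4 hD) hU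
  dsimp only [stub_levelEqConductor] at h4
  exact starGO2SigmaLvl_of hP W W₀ f hf hf₀ hord ((h4 N) hf) L₀ hL₀ q hq hin hout x₀ hx₀ hnr lam hlam hlam2 h℘ hβ

/-- **E1M `DepletedLambdaLawAtTwoMod` (stmt-BirchSwinnertonDyer-20341, ALL conductors) from (F) + (OddManin₂) + UBD** (modularity being the crux's own
first binder): `StarGO2Sigma` by `starGO2Sigma_of_modularity_oddManin_ubd`, `StarOptB` at every level by `SigmaNode.starOptB_of_twoPrints`
(node law from (F) + Edixhoven, GEN 18–20), and the Σ-glue `depletedLambdaLawAtTwoMod_of_starGO2Sigma`.  Compared with v16's door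
`SigmaNode.depletedLambdaLawAtTwoMod_of_threePrints`, Abbes–Ullmo Thm A is replaced by its exact residue (OddManin₂).  CONDITIONAL RESULT; 20341 is
NOT closed; BSD is not proved. [cite: GreenbergVatsal2000, §3 Thm. (3.12), display (28)] [cite: ConradEdixhovenStein2003, §6.1.2 proof of Lemma 6.1.6 (p. 381)]
[cite: CalegariDimitrovTang2025, Thm. 1.0.1] -/
theorem depletedLambdaLawAtTwoMod_of_cusp_oddManin_ubd (hF : gamma1Parametrization_cuspImage_nonsingularReduction)
    (hOdd : ∀ (W₀ : WeierstrassCurve ℚ) [W₀.IsElliptic] [W₀.IsGloballyMinimal] ⦃N : ℕ⦄ [NeZero N]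
      (f : CuspForm (Gamma0 N) 2), IsNewformOf W₀ f → ¬ 2 ∣ N → IsOrdinaryAt W₀ 2 →
      ∀ (L₀ : PeriodPair), IsNeronLatticeOf (W₀.baseChange ℂ) L₀ → ∀ (q : ℤ), q ≠ 0 →
      (∀ z ∈ periodLattice f, (q : ℂ) * z ∈ L₀.lattice) → (∀ z ∈ L₀.lattice, ∃ w ∈ periodLattice f, z = (q : ℂ) * w) →
      ∀ (x₀ : ℚ), HasRationalTwoTorsionX W₀ x₀ → ¬ TwoTorsionRamifiedAtTwo x₀ → Odd q)
    (hU : Literature.NumberTheory.Automorphic.CalegariDimitrovTang2025_unboundedDenominators) :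
    Summit.BirchSwinnertonDyer.BirchSwinnertonDyer.Theses.EisensteinDepletionAtTwo.DepletedLambdaLawAtTwoMod := by
  intro hmod
  have hnf : exists_isNewformOf := hmod
  exact depletedLambdaLawAtTwoMod_of_starGO2Sigma (starGO2Sigma_of_modularity_oddManin_ubd hnf hOdd hU)
    (SigmaNode.starOptB_of_twoPrints hF hU) hmod

/-- **E1M_NSF `DepletedLambdaLawAtTwoModNSF` (stmt-BirchSwinnertonDyer-27021) from (F) + (OddManin₂) + UBD**, by restriction of the all-levels door
(`depletedLambdaLawAtTwoModNSF_of_depletedLambdaLawAtTwoMod`, GEN 6).  CONDITIONAL RESULT; 27021 is NOT closed.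
[cite: GreenbergVatsal2000, §3 Thm. (3.12)] [cite: CalegariDimitrovTang2025, Thm. 1.0.1] -/
theorem depletedLambdaLawAtTwoModNSF_of_cusp_oddManin_ubd (hF : gamma1Parametrization_cuspImage_nonsingularReduction)
    (hOdd : ∀ (W₀ : WeierstrassCurve ℚ) [W₀.IsElliptic] [W₀.IsGloballyMinimal] ⦃N : ℕ⦄ [NeZero N]
      (f : CuspForm (Gamma0 N) 2), IsNewformOf W₀ f → ¬ 2 ∣ N → IsOrdinaryAt W₀ 2 →
      ∀ (L₀ : PeriodPair), IsNeronLatticeOf (W₀.baseChange ℂ) L₀ → ∀ (q : ℤ), q ≠ 0 →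
      (∀ z ∈ periodLattice f, (q : ℂ) * z ∈ L₀.lattice) → (∀ z ∈ L₀.lattice, ∃ w ∈ periodLattice f, z = (q : ℂ) * w) →
      ∀ (x₀ : ℚ), HasRationalTwoTorsionX W₀ x₀ → ¬ TwoTorsionRamifiedAtTwo x₀ → Odd q)
    (hU : Literature.NumberTheory.Automorphic.CalegariDimitrovTang2025_unboundedDenominators) :
    Summit.BirchSwinnertonDyer.BirchSwinnertonDyer.Theses.EisensteinDepletionAtTwo.DepletedLambdaLawAtTwoModNSF :=
  depletedLambdaLawAtTwoModNSF_of_depletedLambdaLawAtTwoMod (depletedLambdaLawAtTwoMod_of_cusp_oddManin_ubd hF hOdd hU)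

/-- **(OddManin₂) ⟸ Abbes–Ullmo Thm A** (bookkeeping: the displayed hypothesis is WEAKER than v16's print): for the optimal datum through
`(f, Λ₀, q)` (`ModularParametrizationData.exists_of_isNewformOf`), Thm A at `p = 2 ∤ N` gives `2 ∤ q`.  The binders «ordinary at 2» and «étale
rational 2-torsion» are not used by this direction. [cite: AbbesUllmo1996, Thm. A] -/
theorem oddManinAtTwo_of_abbesUllmo (hAU : abbesUllmo_not_dvd_maninConstant_of_not_dvd_level) :
    ∀ (W₀ : WeierstrassCurve ℚ) [W₀.IsElliptic] [W₀.IsGloballyMinimal] ⦃N : ℕ⦄ [NeZero N]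
      (f : CuspForm (Gamma0 N) 2), IsNewformOf W₀ f → ¬ 2 ∣ N → IsOrdinaryAt W₀ 2 →
      ∀ (L₀ : PeriodPair), IsNeronLatticeOf (W₀.baseChange ℂ) L₀ → ∀ (q : ℤ), q ≠ 0 →
      (∀ z ∈ periodLattice f, (q : ℂ) * z ∈ L₀.lattice) → (∀ z ∈ L₀.lattice, ∃ w ∈ periodLattice f, z = (q : ℂ) * w) →
      ∀ (x₀ : ℚ), HasRationalTwoTorsionX W₀ x₀ → ¬ TwoTorsionRamifiedAtTwo x₀ → Odd q := by
  intro W₀ _ _ N _ f hW₀ h2N _ L₀ hL₀ q hq0 hin hout x₀ _ _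
  obtain ⟨D', hD'f, hD'L, hD'c⟩ := ModularParametrizationData.exists_of_isNewformOf hW₀ hL₀ hq0 hin
  have hopt : ∀ z ∈ D'.L.lattice, ∃ w ∈ periodLattice D'.f, z = (D'.c : ℂ) * w := by
    rw [hD'L, hD'f, hD'c]
    exact hout
  have h2 := hAU W₀ D' hopt 2 Nat.prime_two h2N
  change ¬ ((2 : ℕ) : ℤ) ∣ D'.c at h2
  rw [hD'c, Nat.cast_ofNat] at h2
  exact Int.not_even_iff_odd.mp fun he ↦ h2 (even_iff_two_dvd.mp he)

end Summit.BirchSwinnertonDyer.BirchSwinnertonDyer.Theorems.DepletionAtTwo.KummerDoor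

end
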